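import Summits.KontsevichZagierPeriods.Zeta5Search.LaiSweepShard

/-!
# `κ₃` sweep certificate — shard file 072 of 127 (shards 504–510 of 889)

HONEST FRAMING. Systematic search; no irrationality claim unless certified. This file only checks,
by `decide +kernel`, shards 504–510 of the order-cell sweep of the `κ₃` point `(74, 2180, 444; δ74)`
(engine `LaiSweepEngine`, soundness `LaiSweepJump/Free/Eval/Shard/Kappa3`; a shard is `⟨regime, n,
p, q, p', q', Lo, Up⟩`: `n` cells from `p/q` to `p'/q'` with integer rate sums in `[Lo, Up]`, `K =
128`, `D = 2^40`). It draws NO conclusion: only the capstone `LaiKappa3SweepCert`, which needs all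
127 shard files, does. Kernel cost of this file ≈ 560 cells × 0.3 s.
-/

namespace Summit.KontsevichZagierPeriods.Zeta5Search.Sweep

set_option maxHeartbeats 100000000 in
/-- Shard 504: 80 cells of regime B from `161/312` to `209/404`.
[cite: Lai2024BallRivoal, §4 Lemma 4.3] -/
theorem shard504 :
    Shard.check 128 (2^40)
      ⟨true, 80, 161, 312, 209, 404, 15198425986550, 18743662220464⟩ = true := by
  decide +kernel

set_option maxHeartbeats 100000000 in
/-- Shard 505: 80 cells of regime B from `209/404` to `195/376`.
[cite: Lai2024BallRivoal, §4 Lemma 4.3] -/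
theorem shard505 :
    Shard.check 128 (2^40)
      ⟨true, 80, 209, 404, 195, 376, 15037225140793, 18563139225818⟩ = true := by
  decide +kernel

set_option maxHeartbeats 100000000 in
/-- Shard 506: 80 cells of regime B from `195/376` to `223/429`.
[cite: Lai2024BallRivoal, §4 Lemma 4.3] -/
theorem shard506 :
    Shard.check 128 (2^40)
      ⟨true, 80, 195, 376, 223, 429, 13954280917159, 17242458703595⟩ = true := by
  decide +kernel

set_option maxHeartbeats 100000000 in
/-- Shard 507: 80 cells of regime B from `223/429` to `173/332`.
[cite: Lai2024BallRivoal, §4 Lemma 4.3] -/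
theorem shard507 :
    Shard.check 128 (2^40)
      ⟨true, 80, 223, 429, 173, 332, 14776927512225, 18276335800920⟩ = true := by
  decide +kernel

set_option maxHeartbeats 100000000 in
/-- Shard 508: 80 cells of regime B from `173/332` to `152/291`.
[cite: Lai2024BallRivoal, §4 Lemma 4.3] -/
theorem shard508 :
    Shard.check 128 (2^40)
      ⟨true, 80, 173, 332, 152, 291, 14566997889040, 18034105094967⟩ = true := by
  decide +kernel

set_option maxHeartbeats 100000000 in
/-- Shard 509: 80 cells of regime B from `152/291` to `100/191`.
[cite: Lai2024BallRivoal, §4 Lemma 4.3] -/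
theorem shard509 :
    Shard.check 128 (2^40)
      ⟨true, 80, 152, 291, 100, 191, 14188307116783, 17581750451485⟩ = true := by
  decide +kernel

set_option maxHeartbeats 100000000 in
/-- Shard 510: 80 cells of regime B from `100/191` to `74/141`.
[cite: Lai2024BallRivoal, §4 Lemma 4.3] -/
theorem shard510 :
    Shard.check 128 (2^40)
      ⟨true, 80, 100, 191, 74, 141, 14620686595684, 18134997800521⟩ = true := by
  decide +kernel

/-- The checked shards of this file, in order. [folklore] -/
def shards072 : List (CheckedShard 128 (2^40)) :=
  [⟨_, shard504⟩, ⟨_, shard505⟩, ⟨_, shard506⟩, ⟨_, shard507⟩, ⟨_, shard508⟩,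
    ⟨_, shard509⟩, ⟨_, shard510⟩]

end Summit.KontsevichZagierPeriods.Zeta5Search.Sweep
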